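import Literature.Topology.FourManifolds.CappellShaneson
import Literature.Topology.FourManifolds.CerfGammaFourProofs
import Literature.Topology.FourManifolds.ConnectedSumTransportProofs
import Literature.Topology.FourManifolds.SurgeredMappingTorus
import HarnessLib

/-!
# Towards `nonempty_diffeomorph_sphere_four_of_isCappellShanesonSphereOf_holds`:
# Gompf's reduction of the Cappell–Shaneson family `Aₘ` to the Akbulut–Kirby sphere

Sibling proof file of `Literature/Topology/FourManifolds/CappellShaneson.lean` (file name: this is
the "Gompf reduction" sibling; `SurgeredMappingTorus.lean` refers to it under its working name
`CappellShanesonProofs.lean`, a name reserved by `CappellShanesonSimplyConnected.lean` for the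
`π₁` sibling), working towards its named fact `Literature.SPC4.nonempty_diffeomorph_sphere_four_of_isCappellShanesonSphereOf X`: for every
`m ∈ ℤ`, every Cappell–Shaneson sphere of `Aₘ = cappellShanesonMatrix m = !![0, 1, 0; 0, 1, 1;
1, 0, m + 1]` (either framing) is diffeomorphic to `S⁴` (R. Gompf, *More Cappell–Shaneson spheres
are standard*, Algebr. Geom. Topol. 10 (2010) 1665–1681, Examples 3.1(a); earlier S. Akbulut,
Ann. of Math. 171 (2010)). The fact packages a whole theory (fishtail neighbourhoods and
logarithmic transformations, Dehn twists and isotopies of `T³`, tubular neighbourhoods and the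
framing of the surgery, and the Kirby calculus of Akbulut–Kirby 1979), none of which the tree or
Mathlib has, so it is decomposed here (provefact triage `XL`) along the architecture of Gompf's
proof, and this file proves the **algebraic and the assembly steps** sorry-free.

## Gompf's proof of Examples 3.1(a) and its decomposition

Gompf 2010: (§2) `X_φ` is the mapping torus of `φ : M → M`, `C ⊂ X_φ` the section circle through
a point `p` fixed by `φ`, and `X^ε_φ` (`ε = 0, 1`) the result of surgery on `C` with either
framing; **Theorem 2.1**: if `α, φ(α)` lie in a torus `T ⊂ M` meeting in one arc, then
`X^ε_{φ∘δᵏ} = X^ε_φ = X^ε_{δᵏ∘φ}` for the Dehn twist `δ` along `T` (proof: a fishtail neighbourhood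
and Lemma 2.2, a multiplicity-`1` log transform is trivial). (§3) For `M = T³` and
`φ = A ∈ SL(3, ℤ)`
with `det (A - I) = 1` in *standard form* `!![0, a, b; 0, c, d; 1, e, f]`, `δ` is isotopic to
`Δ = !![1, -1, 0; 0, 1, 0; 0, 1, 1]`, so the unordered pair of diffeomorphism types `{X⁰_A, X¹_A}`
is unchanged under `A ↦ Δᵏ A` and `A ↦ A Δᵏ`; it also only depends on the conjugacy class of `A`.
**Examples 3.1(a)**: `Δ^{-m} Aₘ = !![0, m+1, m; 0, 1, 1; 1, -m, 1]` has trace `2` and is conjugate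
to `A₀` (explicitly, by `E_m = 1 + m e₁₂`); "since both homotopy spheres arising from `A₀` are
standard (by [AK1] for the untwisted framing and Theorem 4.3 …), the result follows".
**Theorem 4.3**: the two Cappell–Shaneson spheres of `A₀` are diffeomorphic. [AK1] = Akbulut–Kirby,
Topology 18 (1979): the `A₀` sphere with untwisted framing is `S⁴` (a cancelling handle diagram).

The predicate `Literature.IsCappellShanesonSphereOf A X` (`CircleSurgery.lean`) quantifies over the
tubular neighbourhood of the section circle, i.e. over both framings, so "the pair of `A`" is
`{X | IsCappellShanesonSphereOf A X}` up to diffeomorphism and the three inputs become the named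
facts (leaves, each `XL` on its own, to be proved in later sessions):

* `Literature.Topology.FourManifolds.gompf2010_deltaMove` — Thm 2.1/§3: for `A` in standard form with `det (A - 1) = 1`, every
  Cappell–Shaneson sphere of `A` is diffeomorphic to one of `Δ ^ k * A` (all `k ∈ ℤ`; the converse
  inclusion is then automatic, `gompf2010_deltaMove.of_gompfDelta_zpow_mul`);
* `Literature.Topology.FourManifolds.gompf2010_akbulutKirby_framings` — Thm 4.3: any two Cappell–Shaneson spheres of `A₀` are
  diffeomorphic;
* `Literature.Topology.FourManifolds.akbulutKirby1979_sphere_four` — [AK1]: some Cappell–Shaneson sphere of `A₀` is `S⁴`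
  (`↔ IsCappellShanesonSphereOf akbulutKirbyMatrix (𝕊 4)`, `akbulutKirby1979_sphere_four_iff`).

Proved here: the matrix algebra (`Literature.Topology.FourManifolds.gompfDelta`, `Literature.Topology.FourManifolds.coe_gompfDelta_zpow`, `Literature.Topology.FourManifolds.gompfShear` = Mathlib's
`Matrix.SpecialLinearGroup.transvection (0 ≠ 1) m`,
`Literature.Topology.FourManifolds.coe_gompfDelta_zpow_neg_mul_cappellShanesonMatrix`, `Literature.Topology.FourManifolds.gompfShear_inv_mul_mul_gompfShear` :
`E_m⁻¹ (Δ^{-m} Aₘ) E_m = A₀`, `Literature.Topology.FourManifolds.IsGompfStandardForm` and its stability under Δ-moves including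
`det (Δᵏ A - 1) = det (A - 1)`); the `SL(3, ℤ)`-conjugation invariance of Cappell–Shaneson spheres
in the sharp form "same `X`, same mapping torus" (`Literature.Topology.FourManifolds.IsCappellShanesonSphereOf.conj`: precompose
the gluing embeddings of the mapping torus with `torusDiffeomorph P⁻¹` on the fibre — this uses
`Manifold.IsSmoothEmbedding.comp_diffeomorph` of `CerfGammaFourProofs.lean`); transport along
diffeomorphisms (`Literature.Topology.FourManifolds.IsCappellShanesonSphereOf.of_diffeomorph`, by `IsOpenGluing.diffeomorph_comp`
of `ConnectedSumTransportProofs.lean`); and the **assembly**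
`Literature.SPC4.nonempty_diffeomorph_sphere_four_of_isCappellShanesonSphereOf_of hΔ h43 hAK X :
nonempty_diffeomorph_sphere_four_of_isCappellShanesonSphereOf X` (plus the `m = 0` case
`…_akbulutKirby_of h43 hAK X` from the last two leaves only). When the three leaves are discharged,
`…_holds` is this theorem applied to their proofs.

## What remains (DAG, kept in the session NOTES)

* `gompf2010_deltaMove` (XL): only **Theorem 2.1 proper on `T³`** (the fishtail neighbourhood
  `Φ ⊂ X^ε_φ` and Lemma 2.2, the multiplicity-one logarithmic transformation) and the
  well-definedness of the surgery for a framing class remain. The isotopy part is in the tree: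
  `SurgeredMappingTorus.lean` proves that surgered mapping tori of monodromies isotopic rel the
  base point agree (`isSurgeredMappingTorusOf_congr_of_isDiffeotopicToIdRel`), that Gompf's Dehn
  twist `δ_f` along the `x₁x₃`-torus is isotopic rel `1` to the linear `Δᵏ`
  (`isDiffeotopicToIdRel_torusDehnTwist_trans_symm`) and hence that `δ_fᵏ` on either side of the
  monodromy may be replaced by `Δᵏ` (`isSurgeredMappingTorusOf_dehnTwist_trans_torusDiffeomorph_iff`,
  `isSurgeredMappingTorusOf_torusDiffeomorph_trans_dehnTwist_iff`, with `P = gompfDelta ^ k` via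
  `coe_gompfDelta_zpow` and `torusTwist_zpow`); the sibling `CappellShanesonDeltaMove.lean` performs
  this reduction (`gompf2010_deltaMove_of_surgeredMappingToriLE`: the leaf follows from the clause
  "`X_A ≅ X_{δᵏ∘A}`" of Theorem 2.1 for any one genuine Dehn twist `δ`; conversely
  `gompf2010_deltaMove.surgeredMappingToriLE_twistPow` derives all of Theorem 2.1 on `T³` in
  Dehn-twist form from the leaf — D-0026, 2026-08-15: that Dehn-twist form was briefly a second
  named fact and has been merged back into this leaf), and `CappellShanesonDeltaMoveProofs.lean`
  derives the leaf from the framed Theorem 2.1 **F** = `gompf2010_framedTwist`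
  (`gompf2010_deltaMove_of_framedTwist'`), the single remaining obligation.
* `gompf2010_akbulutKirby_framings` (XL): reduced in `GompfFramedSpheres.lean` to the framed
  Theorem 4.3 on Gompf's concrete `X^σ_{A₀}` and the classification of framings of the section
  circle (tubular-neighbourhood uniqueness); the matrix chain `A ↦ … ↦ A₀ ↦ B = C A C⁻¹`, the
  straightenings (Def. 4.1, Prop. 4.2) and `det (B_t + sI) > 0` are proved in
  `GompfStraightening.lean`.
* `akbulutKirby1979_sphere_four`: reduced in `GompfFramedSpheres.lean` to the concrete
  `gompfSphere A₀ σ_lin ≅ S⁴` (`akbulutKirby1979_linearStraightening`, XL: a handle presentation of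
  `X⁰_{A₀}` and its cancellation, Kirby calculus, [AK1]) by the proved
  `akbulutKirby1979_sphere_four_of_framed`; its own discharge is that one-liner (see its docstring)
  and it carries no separate obligation (D-0026 review, 2026-08-15).

## References

* R. E. Gompf, *More Cappell–Shaneson spheres are standard*, Algebr. Geom. Topol. 10 (2010)
  1665–1681, doi:10.2140/agt.2010.10.1665 (arXiv:0908.1914): §2 Thm 2.1, Lemma 2.2; §3 (standard
  form, the matrix `Δ`, conjugacy invariance), Examples 3.1(a); §4 Def. 4.1, Prop. 4.2, Thm 4.3.
  [GompfAGT2010]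
* S. Akbulut, R. Kirby, *An exotic involution of `S⁴`*, Topology 18 (1979) 75–81. [AkbulutKirby1979]
* S. Akbulut, *Cappell–Shaneson homotopy spheres are standard*, Ann. of Math. 171 (2010) 2171–2175.
* A. Kosinski, *Differential Manifolds* (1993), Ch. VI §1 (gluing transported along
  diffeomorphisms). [Kosinski1993]
-/

open scoped Manifold ContDiff Topology
open Set

noncomputable section

namespace Literature.Topology.FourManifolds

universe u v

/-- Local notation: `𝔼 n` is the model Euclidean space `EuclideanSpace ℝ (Fin n)`. -/
local notation "𝔼 " n:arg => EuclideanSpace ℝ (Fin n)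

/-- Local notation: `𝕊 n` is the unit sphere in `EuclideanSpace ℝ (Fin (n + 1))`. -/
local notation "𝕊 " n:arg => (Metric.sphere (0 : EuclideanSpace ℝ (Fin (n + 1))) 1)

/-- Local notation: the model with corners `𝓣 = (𝓡 1).prod ((𝓡 1).prod (𝓡 1))` of `ThreeTorus`. -/
local notation "𝓣" =>
  (ModelWithCorners.prod (𝓡 1) (ModelWithCorners.prod (𝓡 1) (𝓡 1)))

/-! ### Gompf's matrices `Δ`, the shear `E_m`, and the standard form -/

section Matrices

/-- **Gompf's Dehn-twist matrix** `Δ = !![1, -1, 0; 0, 1, 0; 0, 1, 1] ∈ SL(3, ℤ)`: for a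
Cappell–Shaneson matrix `A` in standard form (first column `e₃`), the Dehn twist `δ` of `T³` along
the torus spanned by the first and third coordinate axes, in the direction `A e₁ - e₁ = e₃ - e₁`,
given by Theorem 2.1 is isotopic to the linear diffeomorphism `Δ` (Gompf, *More Cappell–Shaneson
spheres are standard*, Algebr. Geom. Topol. 10 (2010), §3, display defining `Δ`). [cite: GompfAGT2010, §3 (the matrix Δ)] -/
def gompfDelta : Matrix.SpecialLinearGroup (Fin 3) ℤ :=
  ⟨!![1, -1, 0; 0, 1, 0; 0, 1, 1], by decide⟩

/-- The underlying matrix of `gompfDelta`. [folklore] -/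
@[simp] theorem coe_gompfDelta :
    (gompfDelta : Matrix (Fin 3) (Fin 3) ℤ) = !![1, -1, 0; 0, 1, 0; 0, 1, 1] := rfl

/-- **Powers of `Δ`**: `Δ ^ k = !![1, -k, 0; 0, 1, 0; 0, k, 1]` for every `k ∈ ℤ`, so that left
multiplication by `Δ ^ k` subtracts `k` times the second row from the first and adds `k` times the
second row to the third (Gompf 2010, §3: "adding any multiple of the second row to the third while
subtracting the same multiple from the first"). [cite: GompfAGT2010, §3 (the matrix Δ)] -/
theorem coe_gompfDelta_zpow (k : ℤ) :
    ((gompfDelta ^ k : Matrix.SpecialLinearGroup (Fin 3) ℤ) : Matrix (Fin 3) (Fin 3) ℤ) =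
      !![1, -k, 0; 0, 1, 0; 0, k, 1] := by
  induction k using Int.induction_on with
  | zero => simp [Matrix.one_fin_three]
  | succ n ih =>
    rw [zpow_add_one, Matrix.SpecialLinearGroup.coe_mul, ih, coe_gompfDelta]
    ext i j; fin_cases i <;> fin_cases j <;> simp [Matrix.mul_apply, Fin.sum_univ_three]
  | pred n ih =>
    rw [zpow_sub_one, Matrix.SpecialLinearGroup.coe_mul, ih, Matrix.SpecialLinearGroup.coe_inv,
      coe_gompfDelta]
    ext i j
    fin_cases i <;> fin_cases j <;>
      simp [Matrix.mul_apply, Fin.sum_univ_three, Matrix.adjugate_fin_three]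
    ring

/-- **The shear `E_m = 1 + m • e₁₂ = !![1, m, 0; 0, 1, 0; 0, 0, 1] ∈ SL(3, ℤ)`**, the conjugating
matrix of Gompf's Example 3.1(a): conjugation `A ↦ E_m⁻¹ * A * E_m` "adds `m` times the first
column to the second while subtracting `m` times the second row from the first"
(Gompf 2010, §3, Examples 3.1(a)). This is Mathlib's elementary transvection
`Matrix.SpecialLinearGroup.transvection (0 ≠ 1) m = 1 + single 0 1 m` in `SL(3, ℤ)`; the
abbreviation only names Gompf's `E_m` (its inverse is `Matrix.SpecialLinearGroup.transvection_inv`). [cite: GompfAGT2010, Examples 3.1(a)] -/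
abbrev gompfShear (m : ℤ) : Matrix.SpecialLinearGroup (Fin 3) ℤ :=
  Matrix.SpecialLinearGroup.transvection (i := (0 : Fin 3)) (j := 1) (by decide) m

/-- The underlying matrix of `E_m = transvection (0 ≠ 1) m` is `!![1, m, 0; 0, 1, 0; 0, 0, 1]`
(`Matrix.SpecialLinearGroup.transvection_coe`). [folklore] -/
theorem coe_gompfShear (m : ℤ) :
    (gompfShear m : Matrix (Fin 3) (Fin 3) ℤ) = !![1, m, 0; 0, 1, 0; 0, 0, 1] := by
  rw [Matrix.SpecialLinearGroup.transvection_coe]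
  ext i j
  fin_cases i <;> fin_cases j <;> simp

/-- **Gompf's trace-2 representative** (Examples 3.1(a)): `Δ ^ (-m) * Aₘ = !![0, m + 1, m; 0, 1, 1;
1, -m, 1]` — the Δ-move changes `Aₘ` "to have any trace, say 2". [cite: GompfAGT2010, Examples 3.1(a)] -/
theorem coe_gompfDelta_zpow_neg_mul_cappellShanesonMatrix (m : ℤ) :
    ((gompfDelta ^ (-m) * cappellShanesonMatrix m : Matrix.SpecialLinearGroup (Fin 3) ℤ) :
        Matrix (Fin 3) (Fin 3) ℤ) = !![0, m + 1, m; 0, 1, 1; 1, -m, 1] := by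
  rw [Matrix.SpecialLinearGroup.coe_mul, coe_gompfDelta_zpow, coe_cappellShanesonMatrix]
  ext i j
  fin_cases i <;> fin_cases j <;> simp [Matrix.mul_apply, Fin.sum_univ_three]
  ring

/-- **Example 3.1(a) as a matrix identity**: `E_m⁻¹ * (Δ ^ (-m) * Aₘ) * E_m = A₀`, i.e. after the
Δ-move to trace `2` the matrix is conjugate in `SL(3, ℤ)` to the Akbulut–Kirby matrix `A₀`
("this is easy to see directly, by adding `m` times the first column to the second while
subtracting `m` times the second row from the first"; Gompf 2010, §3, Examples 3.1(a)). [cite: GompfAGT2010, Examples 3.1(a)] -/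
theorem gompfShear_inv_mul_mul_gompfShear (m : ℤ) :
    (gompfShear m)⁻¹ * (gompfDelta ^ (-m) * cappellShanesonMatrix m) * gompfShear m =
      akbulutKirbyMatrix := by
  ext i j
  rw [Matrix.SpecialLinearGroup.coe_mul, Matrix.SpecialLinearGroup.coe_mul,
    Matrix.SpecialLinearGroup.transvection_inv, coe_gompfShear, coe_gompfShear,
    coe_gompfDelta_zpow_neg_mul_cappellShanesonMatrix, coe_akbulutKirbyMatrix]
  fin_cases i <;> fin_cases j <;> simp [Matrix.mul_apply, Fin.sum_univ_three]

/-- Equivalently `Aₘ = Δ ^ m * (E_m * A₀ * E_m⁻¹)`: the family `Aₘ` is obtained from `A₀` by an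
`SL(3, ℤ)`-conjugation followed by a Δ-move (Gompf 2010, Examples 3.1(a)). [cite: GompfAGT2010, Examples 3.1(a)] -/
theorem cappellShanesonMatrix_eq_conj (m : ℤ) :
    cappellShanesonMatrix m =
      gompfDelta ^ m * (gompfShear m * akbulutKirbyMatrix * (gompfShear m)⁻¹) := by
  rw [← gompfShear_inv_mul_mul_gompfShear m]
  group

/-- **Gompf's standard form.** `A ∈ SL(3, ℤ)` is in *standard form* if its first column is
`e₃ = (0, 0, 1)ᵀ`, i.e. `A = !![0, a, b; 0, c, d; 1, e, f]`: with `v = e₁` one has `A v = e₃`, so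
`(v, e₂, A v)` is a basis and `ℤ³ / ⟨v, A v⟩` is cyclic, which is what the application of
Theorem 2.1 in the Cappell–Shaneson setting requires; every Cappell–Shaneson matrix is
`GL(3, ℤ)`-conjugate to one in standard form (Aitchison–Rubinstein) (Gompf 2010, §3). [cite: GompfAGT2010, §3 (standard form)] -/
def IsGompfStandardForm (A : Matrix.SpecialLinearGroup (Fin 3) ℤ) : Prop :=
  (A : Matrix (Fin 3) (Fin 3) ℤ) 0 0 = 0 ∧ (A : Matrix (Fin 3) (Fin 3) ℤ) 1 0 = 0 ∧
    (A : Matrix (Fin 3) (Fin 3) ℤ) 2 0 = 1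

/-- Standard form means `A e₁ = e₃` (`v = e₁ ↦ A v = e₃`). [cite: GompfAGT2010, §3 (standard form)] -/
theorem isGompfStandardForm_iff_mulVec (A : Matrix.SpecialLinearGroup (Fin 3) ℤ) :
    IsGompfStandardForm A ↔
      (A : Matrix (Fin 3) (Fin 3) ℤ).mulVec (Pi.single 0 1) = Pi.single 2 1 := by
  simp only [IsGompfStandardForm, Matrix.mulVec_single, MulOpposite.op_one, one_smul, funext_iff,
    Fin.forall_fin_succ, Fin.isValue]
  simp [Matrix.col, Pi.single_apply, Matrix.transpose_apply]

/-- Every member `Aₘ` of the Cappell–Shaneson family is in standard form ("`Aₘ` is in standard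
form with `d = 1`"; Gompf 2010, Examples 3.1(a)). [cite: GompfAGT2010, Examples 3.1(a)] -/
theorem isGompfStandardForm_cappellShanesonMatrix (m : ℤ) :
    IsGompfStandardForm (cappellShanesonMatrix m) := by
  simp [IsGompfStandardForm]

/-- The Akbulut–Kirby matrix `A₀` is in standard form. [cite: GompfAGT2010, Examples 3.1(a)] -/
theorem isGompfStandardForm_akbulutKirbyMatrix : IsGompfStandardForm akbulutKirbyMatrix := by
  simp [IsGompfStandardForm]

/-- Δ-moves preserve standard form: `Δ ^ k` fixes `e₃`, so `Δ ^ k * A` again has first column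
`e₃` (Gompf 2010, §3). [cite: GompfAGT2010, §3 (standard form)] -/
theorem IsGompfStandardForm.gompfDelta_zpow_mul {A : Matrix.SpecialLinearGroup (Fin 3) ℤ}
    (hA : IsGompfStandardForm A) (k : ℤ) : IsGompfStandardForm (gompfDelta ^ k * A) := by
  obtain ⟨h0, h1, h2⟩ := hA
  refine ⟨?_, ?_, ?_⟩ <;>
    simp [Matrix.SpecialLinearGroup.coe_mul, coe_gompfDelta_zpow, Matrix.mul_apply,
      Fin.sum_univ_three, h0, h1, h2]

/-- Δ-moves on the other side preserve standard form too: `A * Δ ^ k` has first column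
`A (Δ ^ k e₁) = A e₁ = e₃` (Gompf 2010, §3). [cite: GompfAGT2010, §3 (standard form)] -/
theorem IsGompfStandardForm.mul_gompfDelta_zpow {A : Matrix.SpecialLinearGroup (Fin 3) ℤ}
    (hA : IsGompfStandardForm A) (k : ℤ) : IsGompfStandardForm (A * gompfDelta ^ k) := by
  obtain ⟨h0, h1, h2⟩ := hA
  refine ⟨?_, ?_, ?_⟩ <;>
    simp [Matrix.SpecialLinearGroup.coe_mul, coe_gompfDelta_zpow, Matrix.mul_apply,
      Fin.sum_univ_three, h0, h1, h2]

/-- **Δ-moves preserve the Cappell–Shaneson condition**: for `A` in standard form,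
`det (Δ ^ k * A - 1) = det (A - 1)` ("`B` is also a Cappell–Shaneson matrix", Gompf 2010, §4; a
polynomial identity in the entries of `A = !![0, a, b; 0, c, d; 1, e, f]`:
`det (A - 1) = -(c - 1)(f - 1) + d e + a d - b c + b` is unchanged under
`(a, b, e, f) ↦ (a - k c, b - k d, e + k c, f + k d)`). [cite: GompfAGT2010, §§3–4 (Δ-moves preserve Cappell–Shaneson matrices)] -/
theorem IsGompfStandardForm.det_gompfDelta_zpow_mul_sub_one
    {A : Matrix.SpecialLinearGroup (Fin 3) ℤ} (hA : IsGompfStandardForm A) (k : ℤ) :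
    (((gompfDelta ^ k * A : Matrix.SpecialLinearGroup (Fin 3) ℤ) : Matrix (Fin 3) (Fin 3) ℤ) -
        1).det = ((A : Matrix (Fin 3) (Fin 3) ℤ) - 1).det := by
  obtain ⟨h0, h1, h2⟩ := hA
  simp only [Matrix.SpecialLinearGroup.coe_mul, coe_gompfDelta_zpow, Matrix.det_fin_three,
    Matrix.sub_apply, Matrix.mul_apply, Fin.sum_univ_three, Matrix.one_apply, h0, h1, h2]
  simp
  ring

/-- Conjugation preserves the Cappell–Shaneson determinant `det (A - 1)`:
`P A P⁻¹ - 1 = P (A - 1) P⁻¹`. [folklore] -/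
theorem det_coe_conj_sub_one (P A : Matrix.SpecialLinearGroup (Fin 3) ℤ) :
    (((P * A * P⁻¹ : Matrix.SpecialLinearGroup (Fin 3) ℤ) : Matrix (Fin 3) (Fin 3) ℤ) - 1).det =
      ((A : Matrix (Fin 3) (Fin 3) ℤ) - 1).det := by
  have h1 : ((P * A * P⁻¹ : Matrix.SpecialLinearGroup (Fin 3) ℤ) : Matrix (Fin 3) (Fin 3) ℤ) - 1 =
      (P : Matrix (Fin 3) (Fin 3) ℤ) * ((A : Matrix (Fin 3) (Fin 3) ℤ) - 1) *
        ((P⁻¹ : Matrix.SpecialLinearGroup (Fin 3) ℤ) : Matrix (Fin 3) (Fin 3) ℤ) := by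
    rw [Matrix.mul_sub, Matrix.sub_mul, mul_one, ← Matrix.SpecialLinearGroup.coe_mul P P⁻¹,
      mul_inv_cancel, Matrix.SpecialLinearGroup.coe_one, Matrix.SpecialLinearGroup.coe_mul,
      Matrix.SpecialLinearGroup.coe_mul]
  rw [h1, Matrix.det_mul, Matrix.det_mul, Matrix.SpecialLinearGroup.det_coe,
    Matrix.SpecialLinearGroup.det_coe, one_mul, mul_one]

end Matrices

/-! ### Invariance of `IsCappellShanesonSphereOf` under conjugation and diffeomorphism -/

section Invariance

/-- **Cappell–Shaneson spheres depend only on the conjugacy class of the matrix** (the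
`SL(3, ℤ)` part of Gompf 2010, §3: "this pair only depends on the conjugacy class of `A` in
`GL(3, ℤ)`"), in the sharp relational form: if `X` is a Cappell–Shaneson sphere of `A` then it is
one of `P A P⁻¹`, for the *same* mapping torus `T` and section circle: a corollary of the
framing-free conjugation invariance `IsSurgeredMappingTorusOf.conj` of `SurgeredMappingTorus.lean`
(precompose the two gluing embeddings with `torusDiffeomorph P⁻¹` on the fibre, which fixes the
base point `1 ∈ T³`) together with `torusMap_mul` and `det (P A P⁻¹ - 1) = det (A - 1)`
(`det_coe_conj_sub_one`). [cite: GompfAGT2010, §3 (conjugacy invariance)] -/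
theorem IsCappellShanesonSphereOf.conj {A : Matrix.SpecialLinearGroup (Fin 3) ℤ} {X : Type*}
    [TopologicalSpace X] [ChartedSpace (𝔼 4) X] (h : IsCappellShanesonSphereOf A X)
    (P : Matrix.SpecialLinearGroup (Fin 3) ℤ) : IsCappellShanesonSphereOf (P * A * P⁻¹) X := by
  refine ⟨by rw [det_coe_conj_sub_one]; exact h.det_sub_one, ?_⟩
  refine (h.isSurgeredMappingTorusOf.conj (torusDiffeomorph P⁻¹)
    (torusDiffeomorph_apply_one _)).congr fun x => ?_
  change torusMap (((P⁻¹)⁻¹ : Matrix.SpecialLinearGroup (Fin 3) ℤ) : Matrix (Fin 3) (Fin 3) ℤ)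
      (torusMap (A : Matrix (Fin 3) (Fin 3) ℤ)
        (torusMap ((P⁻¹ : Matrix.SpecialLinearGroup (Fin 3) ℤ) : Matrix (Fin 3) (Fin 3) ℤ) x)) =
    torusMap ((P * A * P⁻¹ : Matrix.SpecialLinearGroup (Fin 3) ℤ) : Matrix (Fin 3) (Fin 3) ℤ) x
  rw [inv_inv, Matrix.SpecialLinearGroup.coe_mul, Matrix.SpecialLinearGroup.coe_mul, torusMap_mul,
    torusMap_mul]
  rfl

/-- Conjugation the other way round: a Cappell–Shaneson sphere of `A` is one of `P⁻¹ A P`. [cite: GompfAGT2010, §3 (conjugacy invariance)] -/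
theorem IsCappellShanesonSphereOf.conj' {A : Matrix.SpecialLinearGroup (Fin 3) ℤ} {X : Type*}
    [TopologicalSpace X] [ChartedSpace (𝔼 4) X] (h : IsCappellShanesonSphereOf A X)
    (P : Matrix.SpecialLinearGroup (Fin 3) ℤ) : IsCappellShanesonSphereOf (P⁻¹ * A * P) X := by
  simpa using h.conj P⁻¹

/-- The predicates for conjugate matrices agree. [cite: GompfAGT2010, §3 (conjugacy invariance)] -/
theorem isCappellShanesonSphereOf_conj_iff {A : Matrix.SpecialLinearGroup (Fin 3) ℤ} {X : Type*}
    [TopologicalSpace X] [ChartedSpace (𝔼 4) X] (P : Matrix.SpecialLinearGroup (Fin 3) ℤ) :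
    IsCappellShanesonSphereOf (P * A * P⁻¹) X ↔ IsCappellShanesonSphereOf A X := by
  refine ⟨fun h => ?_, fun h => h.conj P⟩
  have h' := h.conj' P
  rwa [show P⁻¹ * (P * A * P⁻¹) * P = A by group] at h'

/-- **Transport along diffeomorphisms.** If `X` is a Cappell–Shaneson sphere of `A` and
`e : X ≅ Y` is a diffeomorphism onto a smooth 4-manifold (atlas on `ℝ⁴`), then `Y` is a
Cappell–Shaneson sphere of `A`: keep the mapping torus, the section circle and the tubular
neighbourhood, and post-compose the two surgery gluing embeddings with `e`
(`IsOpenGluing.diffeomorph_comp`, Kosinski, *Differential Manifolds*, VI.1). [cite: Kosinski1993, Ch. VI §1, proof of Thm 1.1] -/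
theorem IsCappellShanesonSphereOf.of_diffeomorph {A : Matrix.SpecialLinearGroup (Fin 3) ℤ}
    {X : Type*} [TopologicalSpace X] [ChartedSpace (𝔼 4) X] {Y : Type*} [TopologicalSpace Y]
    [ChartedSpace (𝔼 4) Y] [IsManifold (𝓡 4) ∞ Y] (h : IsCappellShanesonSphereOf A X)
    (e : X ≃ₘ⟮𝓡 4, 𝓡 4⟯ Y) : IsCappellShanesonSphereOf A Y := by
  obtain ⟨hdet, T, _, _, _, _, _, _, jA, jB, hG, c, hc, hrange, ν, hglue⟩ := h
  exact ⟨hdet, T, ‹_›, ‹_›, ‹_›, ‹_›, ‹_›, ‹_›, jA, jB, hG, c, hc, hrange, ν,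
    hglue.diffeomorph_comp e rfl⟩

/-- Diffeomorphic smooth 4-manifolds are Cappell–Shaneson spheres of the same matrices. [cite: Kosinski1993, Ch. VI §1, proof of Thm 1.1] -/
theorem isCappellShanesonSphereOf_iff_of_diffeomorph {A : Matrix.SpecialLinearGroup (Fin 3) ℤ}
    {X : Type*} [TopologicalSpace X] [ChartedSpace (𝔼 4) X] [IsManifold (𝓡 4) ∞ X] {Y : Type*}
    [TopologicalSpace Y] [ChartedSpace (𝔼 4) Y] [IsManifold (𝓡 4) ∞ Y] (e : X ≃ₘ⟮𝓡 4, 𝓡 4⟯ Y) :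
    IsCappellShanesonSphereOf A X ↔ IsCappellShanesonSphereOf A Y :=
  ⟨fun h => h.of_diffeomorph e, fun h => h.of_diffeomorph e.symm⟩

end Invariance

/-! ### The leaves: three named facts (Gompf 2010 Thm 2.1/§3, Thm 4.3; Akbulut–Kirby 1979) -/

section Facts

/-- **Gompf 2010, Theorem 2.1 in the Cappell–Shaneson setting (§3): Δ-moves do not change the
Cappell–Shaneson spheres.** Let `A ∈ SL(3, ℤ)` be a Cappell–Shaneson matrix (`det (A - 1) = 1`)
in standard form (first column `e₃`). Gompf, *More Cappell–Shaneson spheres are standard*, Algebr.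
Geom. Topol. 10 (2010), §3: with `v = e₁` the quotient `ℤ³ / ⟨v, A v⟩` is cyclic, so there is a
2-torus `T ⊂ T³` (spanned by the first and third coordinate axes) containing the circles of `v`
and `A v` and satisfying the hypotheses of Theorem 2.1 (the framing hypothesis holds
automatically), whose Dehn twist `δ` in the direction `A v - v` is isotopic to the linear
diffeomorphism `Δ = gompfDelta`; hence, by Theorem 2.1 (`X^ε_{φ ∘ δᵏ} = X^ε_φ = X^ε_{δᵏ ∘ φ}` for
`ε = 0, 1` and all `k ∈ ℤ`), "this allows us to change `A` (in standard form) by adding any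
multiple of the second row to the third while subtracting the same multiple from the first
[`A ↦ Δ ^ k * A`] … without changing the resulting pair of diffeomorphism types" of the two
Cappell–Shaneson homotopy spheres of `A`.

Framing-free formal rendering (the predicate `IsCappellShanesonSphereOf A X` allows both framings,
i.e. describes exactly Gompf's unordered pair for `A`; the linear monodromy `torusDiffeomorph A`
and Gompf's monodromy straightened near `0` are isotopic rel `0`, so their mapping tori are
diffeomorphic by a diffeomorphism preserving the section circle): every Cappell–Shaneson sphere
`X` of `A` is diffeomorphic to some Cappell–Shaneson sphere `X'` of `Δ ^ k * A` (a closed smooth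
4-manifold in `Type`), for every `k ∈ ℤ`. Since `Δ ^ (-k) * (Δ ^ k * A) = A` stays in standard
form with the same `det (· - 1)` (`IsGompfStandardForm.gompfDelta_zpow_mul`,
`IsGompfStandardForm.det_gompfDelta_zpow_mul_sub_one`), the converse inclusion follows
(`gompf2010_deltaMove.of_gompfDelta_zpow_mul`), so this states exactly that the sets of
diffeomorphism types agree. Only the row move (left multiplication) is recorded; the column move
`A ↦ A * Δ ^ k` of loc. cit. is not needed here. Size: XL (Theorem 2.1 = fishtail neighbourhoods and
multiplicity-one logarithmic transformations, Lemma 2.2, plus isotopy of `δ` to `Δ` and the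
well-definedness of `X^ε_φ`). [cite: GompfAGT2010, Thm 2.1 and §3 (Δ-moves on matrices in standard form)] -/
def gompf2010_deltaMove : Prop :=
  ∀ (A : Matrix.SpecialLinearGroup (Fin 3) ℤ) (_ : IsGompfStandardForm A)
    (_ : ((A : Matrix (Fin 3) (Fin 3) ℤ) - 1).det = 1) (k : ℤ)
    (X : Type u) [TopologicalSpace X] [T2Space X] [SecondCountableTopology X]
    [ChartedSpace (𝔼 4) X] [IsManifold (𝓡 4) ∞ X] [CompactSpace X],
    IsCappellShanesonSphereOf A X →
      ∃ (X' : Type) (_ : TopologicalSpace X') (_ : T2Space X') (_ : SecondCountableTopology X')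
        (_ : ChartedSpace (𝔼 4) X') (_ : IsManifold (𝓡 4) ∞ X') (_ : CompactSpace X'),
        IsCappellShanesonSphereOf (gompfDelta ^ k * A) X' ∧ Nonempty (X ≃ₘ⟮𝓡 4, 𝓡 4⟯ X')

/-- The converse inclusion packaged: under `gompf2010_deltaMove`, every Cappell–Shaneson sphere of
`Δ ^ k * A` (with `A` a Cappell–Shaneson matrix in standard form) is diffeomorphic to one of `A` —
apply the fact to `Δ ^ k * A` and `-k` (Gompf 2010, §3). [cite: GompfAGT2010, Thm 2.1 and §3 (Δ-moves on matrices in standard form)] -/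
theorem gompf2010_deltaMove.of_gompfDelta_zpow_mul (hΔ : gompf2010_deltaMove.{u})
    {A : Matrix.SpecialLinearGroup (Fin 3) ℤ} (hA : IsGompfStandardForm A)
    (hdet : ((A : Matrix (Fin 3) (Fin 3) ℤ) - 1).det = 1) (k : ℤ) (X : Type u) [TopologicalSpace X]
    [T2Space X] [SecondCountableTopology X] [ChartedSpace (𝔼 4) X] [IsManifold (𝓡 4) ∞ X]
    [CompactSpace X] (h : IsCappellShanesonSphereOf (gompfDelta ^ k * A) X) :
    ∃ (X' : Type) (_ : TopologicalSpace X') (_ : T2Space X') (_ : SecondCountableTopology X')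
      (_ : ChartedSpace (𝔼 4) X') (_ : IsManifold (𝓡 4) ∞ X') (_ : CompactSpace X'),
      IsCappellShanesonSphereOf A X' ∧ Nonempty (X ≃ₘ⟮𝓡 4, 𝓡 4⟯ X') := by
  have := hΔ (gompfDelta ^ k * A) (hA.gompfDelta_zpow_mul k)
    (by rw [hA.det_gompfDelta_zpow_mul_sub_one]; exact hdet) (-k) X h
  rwa [← mul_assoc, ← zpow_add, neg_add_cancel, zpow_zero, one_mul] at this

/-- **Gompf 2010, Theorem 4.3: the two Cappell–Shaneson spheres given by the Akbulut–Kirby matrix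
`A₀ = !![0, 1, 0; 0, 1, 1; 1, 0, 1]` are diffeomorphic** (Gompf, Algebr. Geom. Topol. 10 (2010),
Thm 4.3: four applications of Theorem 2.1 lead from a trace-`4` Cappell–Shaneson matrix `A` through
`A₀` to `B = C A C⁻¹`, and the resulting self-map of straightenings is the non-trivial element of
`π₁ GL(3, ℝ) = ℤ/2`, computed as a mod-`2` winding number; this bypasses [AK2], [G1] = Akbulut–Kirby,
Topology 24 (1985) followed by Gompf, *Killing the Akbulut–Kirby 4-sphere*, Topology 30 (1991)). Framing-free formal rendering: any two Cappell–Shaneson spheres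
of `A₀` — closed smooth 4-manifolds `X`, `X'` with `IsCappellShanesonSphereOf akbulutKirbyMatrix`,
whichever framings (tubular neighbourhoods) their surgeries used — are diffeomorphic. Besides
Theorem 4.3 proper this packages the well-definedness of Gompf's `X^ε_φ` (uniqueness of the mapping
torus and of surgery along isotopic tubular neighbourhoods; two framings, `π₁ SO(3) = ℤ/2`), which
loc. cit. §2 presupposes. Size: XL. [cite: GompfAGT2010, Thm 4.3] -/
def gompf2010_akbulutKirby_framings : Prop :=
  ∀ (X : Type u) [TopologicalSpace X] [T2Space X] [SecondCountableTopology X]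
    [ChartedSpace (𝔼 4) X] [IsManifold (𝓡 4) ∞ X] [CompactSpace X]
    (X' : Type v) [TopologicalSpace X'] [T2Space X'] [SecondCountableTopology X']
    [ChartedSpace (𝔼 4) X'] [IsManifold (𝓡 4) ∞ X'] [CompactSpace X'],
    IsCappellShanesonSphereOf akbulutKirbyMatrix X →
      IsCappellShanesonSphereOf akbulutKirbyMatrix X' → Nonempty (X ≃ₘ⟮𝓡 4, 𝓡 4⟯ X')

/-- **Akbulut–Kirby 1979: the Cappell–Shaneson sphere of `A₀` with the untwisted framing is
diffeomorphic to `S⁴`** (S. Akbulut, R. Kirby, *An exotic involution of `S⁴`*, Topology 18 (1979)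
75–81: a handle diagram of the Cappell–Shaneson homotopy 4-sphere built from the monodromy
`A₀ = !![0, 1, 0; 0, 1, 1; 1, 0, 1]` is drawn and shown to cancel, so that it is `S⁴`; as recorded
by Gompf, Algebr. Geom. Topol. 10 (2010), §1: "The first progress in trivializing Cappell–Shaneson
spheres was due to Akbulut and Kirby [AK1] in 1979, showing via Kirby calculus that the example
with `m = 0` and untwisted framing is `S⁴`. Aitchison and Rubinstein [AR] observed that this
framing is not the one arising (as claimed in [AK1]) from an exotic `ℝP⁴`"). Framing-free formal
rendering (weaker than the printed result only in not naming the framing): *some*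
Cappell–Shaneson sphere of `A₀ = akbulutKirbyMatrix` — a closed smooth 4-manifold in `Type` — is
diffeomorphic to `S⁴`; equivalently (`akbulutKirby1979_sphere_four_iff`) `S⁴` itself is a
Cappell–Shaneson sphere of `A₀`. The printed theorem has an independent second proof: Aitchison and
Rubinstein (Contemp. Math. 35 (1984)) "showed that for all `Aₘ` the example with untwisted framing
is standard" (Gompf, loc. cit., §1), and with the twisted `A₀`-sphere standard as well ([AK2]
followed by Gompf, Topology 30 (1991); or [AK1] with Gompf 2010, Thm 4.3) the `∃`-form does not
depend on which framing class the tree's conventions single out.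

**Discharge path (D-0026 bad-split review, 2026-08-15): this statement is not an independent
proof obligation and must never be split, restated or re-vendored.** `GompfFramedSpheres.lean`
(which imports this file) proves
`akbulutKirby1979_sphere_four_of_framed : akbulutKirby1979_linearStraightening →
akbulutKirby1979_sphere_four` — Gompf's concrete `X^{σ_lin}_{A₀} = gompfSphere akbulutKirbyMatrix
akbulutKirbyLinearPath` is a Cappell–Shaneson sphere of `A₀` in `Type`
(`isCappellShanesonSphereOf_gompfSphere_akbulutKirby`) — so the discharge is the one-liner
`theorem akbulutKirby1979_sphere_four_holds : akbulutKirby1979_sphere_four :=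
akbulutKirby1979_sphere_four_of_framed akbulutKirby1979_linearStraightening_holds`, to be placed in
a sibling file importing `GompfFramedSpheres.lean` (not here: import cycle). The Kirby calculus of
[AK1] (size XL: a handle presentation of the surgered mapping torus and its cancellation) is the
obligation of the single concrete fact `akbulutKirby1979_linearStraightening` and of nothing else;
conversely the named fact `nonempty_diffeomorph_sphere_four_of_isCappellShanesonSphereOf_akbulutKirby`
over `Type` gives both back (`akbulutKirby1979_sphere_four_of_forall`,
`CappellShanesonAkbulutKirbyProofs.lean`). [cite: AkbulutKirby1979, main theorem (Σ ≅ S⁴)] [cite: GompfAGT2010, §1 (on AK1)] -/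
def akbulutKirby1979_sphere_four : Prop :=
  ∃ (X : Type) (_ : TopologicalSpace X) (_ : T2Space X) (_ : SecondCountableTopology X)
    (_ : ChartedSpace (𝔼 4) X) (_ : IsManifold (𝓡 4) ∞ X) (_ : CompactSpace X),
    IsCappellShanesonSphereOf akbulutKirbyMatrix X ∧ Nonempty (X ≃ₘ⟮𝓡 4, 𝓡 4⟯ ↥(𝕊 4))

/-- `akbulutKirby1979_sphere_four` says exactly that the standard `S⁴` is a Cappell–Shaneson
sphere of `A₀` (transport the construction along the diffeomorphism,
`IsCappellShanesonSphereOf.of_diffeomorph`). [cite: AkbulutKirby1979, main theorem (Σ ≅ S⁴)] -/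
theorem akbulutKirby1979_sphere_four_iff :
    akbulutKirby1979_sphere_four ↔ IsCappellShanesonSphereOf akbulutKirbyMatrix ↥(𝕊 4) := by
  constructor
  · rintro ⟨X, _, _, _, _, _, _, hX, ⟨e⟩⟩
    exact hX.of_diffeomorph e
  · intro h
    exact ⟨↥(𝕊 4), inferInstance, inferInstance, inferInstance, inferInstance, inferInstance,
      inferInstance, h, ⟨Diffeomorph.refl _ _ _⟩⟩

end Facts

end Literature.Topology.FourManifolds

/-! ### Assembly: Gompf's Example 3.1(a) -/

namespace Literature.Topology.FourManifolds

universe u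

/-- Local notation: `𝔼 n` is the model Euclidean space `EuclideanSpace ℝ (Fin n)`. -/
local notation "𝔼 " n:arg => EuclideanSpace ℝ (Fin n)

/-- Local notation: `𝕊 n` is the unit sphere in `EuclideanSpace ℝ (Fin (n + 1))`. -/
local notation "𝕊 " n:arg => (Metric.sphere (0 : EuclideanSpace ℝ (Fin (n + 1))) 1)

variable (X : Type u) [TopologicalSpace X] [T2Space X] [SecondCountableTopology X]
  [ChartedSpace (𝔼 4) X] [IsManifold (𝓡 4) ∞ X] [CompactSpace X]

/-- **The Akbulut–Kirby spheres are standard, from Theorem 4.3 and [AK1]** ("both homotopy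
spheres arising from `A₀` are standard (by [AK1] for the untwisted framing and Theorem 4.3)",
Gompf 2010, Examples 3.1(a)): the named fact
`nonempty_diffeomorph_sphere_four_of_isCappellShanesonSphereOf_akbulutKirby X` follows from
`gompf2010_akbulutKirby_framings` and `akbulutKirby1979_sphere_four`. [cite: GompfAGT2010, Examples 3.1(a)] -/
theorem nonempty_diffeomorph_sphere_four_of_isCappellShanesonSphereOf_akbulutKirby_of
    (h43 : gompf2010_akbulutKirby_framings.{u, 0}) (hAK : akbulutKirby1979_sphere_four) :
    nonempty_diffeomorph_sphere_four_of_isCappellShanesonSphereOf_akbulutKirby X := by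
  intro h
  obtain ⟨S, _, _, _, _, _, _, hS, ⟨eS⟩⟩ := hAK
  obtain ⟨e⟩ := h43 X S h hS
  exact ⟨e.trans eS⟩

/-- **Gompf 2010, Examples 3.1(a) — the assembly step, proved.** The named fact
`nonempty_diffeomorph_sphere_four_of_isCappellShanesonSphereOf X` (every Cappell–Shaneson sphere
of every `Aₘ`, either framing, is diffeomorphic to `S⁴`) follows from the three leaves
`gompf2010_deltaMove` (Thm 2.1/§3), `gompf2010_akbulutKirby_framings` (Thm 4.3) and
`akbulutKirby1979_sphere_four` ([AK1]), exactly as in loc. cit.: "Since `Aₘ` is in standard form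
with `d = 1`, we can change it to have any trace, say `2`. The resulting matrix
[`Δ ^ (-m) * Aₘ`, `coe_gompfDelta_zpow_neg_mul_cappellShanesonMatrix`] must be conjugate to `A₀`
[explicitly by `E_m`, `gompfShear_inv_mul_mul_gompfShear`] … Since both homotopy spheres arising
from `A₀` are standard (by [AK1] for the untwisted framing and Theorem 4.3 …), the result
follows." Formally: a Cappell–Shaneson sphere `X` of `Aₘ` is diffeomorphic to one, `X'`, of
`Δ ^ (-m) * Aₘ` (Δ-move), which is one of `E_m⁻¹ (Δ ^ (-m) Aₘ) E_m = A₀`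
(`IsCappellShanesonSphereOf.conj'`, proved), hence diffeomorphic to the Akbulut–Kirby sphere that
is `S⁴`. [cite: GompfAGT2010, Examples 3.1(a)] -/
theorem nonempty_diffeomorph_sphere_four_of_isCappellShanesonSphereOf_of
    (hΔ : gompf2010_deltaMove.{u}) (h43 : gompf2010_akbulutKirby_framings.{0, 0})
    (hAK : akbulutKirby1979_sphere_four) :
    nonempty_diffeomorph_sphere_four_of_isCappellShanesonSphereOf X := by
  intro m h
  obtain ⟨X', _, _, _, _, _, _, h', ⟨e⟩⟩ := hΔ (cappellShanesonMatrix m)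
    (isGompfStandardForm_cappellShanesonMatrix m) (det_cappellShanesonMatrix_sub_one m) (-m) X h
  have h₀ : IsCappellShanesonSphereOf akbulutKirbyMatrix X' := by
    rw [← gompfShear_inv_mul_mul_gompfShear m]
    exact h'.conj' (gompfShear m)
  obtain ⟨S, _, _, _, _, _, _, hS, ⟨eS⟩⟩ := hAK
  obtain ⟨e'⟩ := h43 X' S h₀ hS
  exact ⟨e.trans (e'.trans eS)⟩

end Literature.Topology.FourManifolds

/-! ### The matrix printed in [AK1] and its conjugacy to `A₀`

Akbulut–Kirby, *An exotic involution of `S⁴`*, Topology 18 (1979) 75–81, state their theorem for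
the fake `ℝP⁴` "built with the matrix `A = !![0, 1, 0; 0, 0, 1; -1, 1, 0]`" (p. 75, Theorem), an
orientation-reversing automorphism of `T³ = ℝ³/(2ℤ)³`; the homotopy sphere shown to be `S⁴` is
the double cover `Σ⁴ = Ĉ ∪ (S² × B²)`, where `Ĉ` is the mapping torus of `A²` restricted to
`T³ ∖ V` and `A² = !![0, 0, 1; -1, 1, 0; 0, -1, 1]` (p. 76), the `S² × B²` being added "with no
twist" (p. 77) — i.e. `Σ⁴` is the Cappell–Shaneson sphere of the `SL(3, ℤ)` matrix `A²`
(`det (A² - 1) = 1`, trace `2`) with the untwisted framing. The tree's `akbulutKirbyMatrix = A₀`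
is the trace-`2` representative used by Akbulut–Kirby (1985) and Gompf (2010); the two matrices
are conjugate in `SL(3, ℤ)` by the explicit `S = !![1, 0, 0; 0, 0, 1; 0, -1, 0]`
(`S A² S⁻¹ = A₀`), so by the conjugation invariance proved above the named fact
`akbulutKirby1979_sphere_four` is *equivalently* the framing-free form of the theorem for the
matrix as printed (`akbulutKirby1979_sphere_four_iff_sq`). -/

namespace Literature.Topology.FourManifolds

/-- Local notation: `𝔼 n` is the model Euclidean space `EuclideanSpace ℝ (Fin n)`. -/
local notation "𝔼 " n:arg => EuclideanSpace ℝ (Fin n)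

/-- Local notation: `𝕊 n` is the unit sphere in `EuclideanSpace ℝ (Fin (n + 1))`. -/
local notation "𝕊 " n:arg => (Metric.sphere (0 : EuclideanSpace ℝ (Fin (n + 1))) 1)

/-- **The matrix of [AK1]**: `A = !![0, 1, 0; 0, 0, 1; -1, 1, 0]`, "the orientation reversing
linear map" of `ℝ³` inducing `A : T³ → T³`, `T³ = ℝ³/(2ℤ)³`, from which the fake `ℝP⁴`
`Q⁴ = (ℝP² ×~ B²) ∪ C` is built, `C` the mapping torus of `A` on `T³ ∖ V` (Akbulut–Kirby,
Topology 18 (1979), p. 75: Theorem and the paragraph "Proof. Recall the construction of `Q⁴`").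
It has determinant `-1`, so it is recorded as an integer matrix, not an element of `SL(3, ℤ)`. [cite: AkbulutKirby1979, p. 75 (Theorem; the matrix A)] -/
def akbulutKirby1979Matrix : Matrix (Fin 3) (Fin 3) ℤ := !![0, 1, 0; 0, 0, 1; -1, 1, 0]

/-- `det A = -1`: the matrix of [AK1] is orientation reversing (loc. cit., p. 75). [cite: AkbulutKirby1979, p. 75 (Theorem; the matrix A)] -/
theorem det_akbulutKirby1979Matrix : akbulutKirby1979Matrix.det = -1 := by
  simp [akbulutKirby1979Matrix, Matrix.det_fin_three]

/-- **The monodromy `A²` of the double cover in [AK1]**: "the double cover of `C` which is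
`Ĉ = {mapping torus of A² | T³ - V}`", "Since `A² = !![0, 0, 1; -1, 1, 0; 0, -1, 1]` …"
(Akbulut–Kirby 1979, pp. 75–76); an element of `SL(3, ℤ)`. The homotopy sphere `Σ⁴ = Ĉ ∪ S² × B²`
of the Theorem (p. 75) is the Cappell–Shaneson sphere of this matrix with the untwisted framing
("In our case there is no twist", p. 77). [cite: AkbulutKirby1979, pp. 75–76 (Ĉ and the matrix A²)] -/
def akbulutKirby1979MatrixSq : Matrix.SpecialLinearGroup (Fin 3) ℤ :=
  ⟨!![0, 0, 1; -1, 1, 0; 0, -1, 1], by decide⟩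

/-- The underlying matrix of `akbulutKirby1979MatrixSq`. [folklore] -/
@[simp] theorem coe_akbulutKirby1979MatrixSq :
    (akbulutKirby1979MatrixSq : Matrix (Fin 3) (Fin 3) ℤ) = !![0, 0, 1; -1, 1, 0; 0, -1, 1] := rfl

/-- `A²` is indeed the square of the printed matrix `A` (Akbulut–Kirby 1979, p. 76). [cite: AkbulutKirby1979, pp. 75–76 (Ĉ and the matrix A²)] -/
theorem akbulutKirby1979Matrix_mul_self :
    akbulutKirby1979Matrix * akbulutKirby1979Matrix =
      (akbulutKirby1979MatrixSq : Matrix (Fin 3) (Fin 3) ℤ) := by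
  ext i j
  rw [coe_akbulutKirby1979MatrixSq, akbulutKirby1979Matrix]
  fin_cases i <;> fin_cases j <;> simp [Matrix.mul_apply, Fin.sum_univ_three]

/-- `det (A² - 1) = 1`: the monodromy of [AK1] is a Cappell–Shaneson matrix, so that `Ĉ ∪ S² × B²`
is a homotopy 4-sphere (Akbulut–Kirby 1979, p. 75; Cappell–Shaneson 1976). [cite: AkbulutKirby1979, pp. 75–76 (Ĉ and the matrix A²)] -/
theorem det_akbulutKirby1979MatrixSq_sub_one :
    ((akbulutKirby1979MatrixSq : Matrix (Fin 3) (Fin 3) ℤ) - 1).det = 1 := by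
  decide

/-- `tr A² = 2`, the trace of `A₀` (`trace_akbulutKirbyMatrix`): both lie in the single conjugacy
class of Cappell–Shaneson matrices of trace `2` (Gompf 2010, Examples 3.1(a): "there is only one
conjugacy class with trace 2"). [cite: GompfAGT2010, Examples 3.1(a)] -/
theorem trace_akbulutKirby1979MatrixSq :
    (akbulutKirby1979MatrixSq : Matrix (Fin 3) (Fin 3) ℤ).trace = 2 := by
  decide

/-- **An explicit conjugator** `S = !![1, 0, 0; 0, 0, 1; 0, -1, 0] ∈ SL(3, ℤ)` with
`S A² S⁻¹ = A₀` (`akbulutKirby1979Conj_mul_sq_mul_inv`): both `A²` and `A₀` have characteristic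
polynomial `λ³ - 2λ² + λ - 1` and cyclic vector `e₁`, and `S` is the resulting change of basis
(a witness of the conjugacy asserted in Gompf 2010, Examples 3.1(a)). [folklore] -/
def akbulutKirby1979Conj : Matrix.SpecialLinearGroup (Fin 3) ℤ :=
  ⟨!![1, 0, 0; 0, 0, 1; 0, -1, 0], by decide⟩

/-- The underlying matrix of `akbulutKirby1979Conj`. [folklore] -/
@[simp] theorem coe_akbulutKirby1979Conj :
    (akbulutKirby1979Conj : Matrix (Fin 3) (Fin 3) ℤ) = !![1, 0, 0; 0, 0, 1; 0, -1, 0] := rfl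

/-- `S A² = A₀ S` (both equal `!![0, 0, 1; 0, -1, 1; 1, -1, 0]`). [folklore] -/
theorem akbulutKirby1979Conj_mul_sq :
    akbulutKirby1979Conj * akbulutKirby1979MatrixSq = akbulutKirbyMatrix * akbulutKirby1979Conj := by
  ext i j
  rw [Matrix.SpecialLinearGroup.coe_mul, Matrix.SpecialLinearGroup.coe_mul,
    coe_akbulutKirby1979Conj, coe_akbulutKirby1979MatrixSq, coe_akbulutKirbyMatrix]
  fin_cases i <;> fin_cases j <;> simp [Matrix.mul_apply, Fin.sum_univ_three]

/-- **`A²` is `SL(3, ℤ)`-conjugate to the Akbulut–Kirby matrix `A₀`**: `S A² S⁻¹ = A₀`. [folklore] -/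
theorem akbulutKirby1979Conj_mul_sq_mul_inv :
    akbulutKirby1979Conj * akbulutKirby1979MatrixSq * akbulutKirby1979Conj⁻¹ = akbulutKirbyMatrix := by
  rw [akbulutKirby1979Conj_mul_sq, mul_inv_cancel_right]

/-- **The Cappell–Shaneson spheres of the matrix printed in [AK1] are exactly those of `A₀`**
(conjugation invariance, `isCappellShanesonSphereOf_conj_iff`, with the explicit conjugator
`akbulutKirby1979Conj`; Gompf 2010, §3: the pair of spheres "only depends on the conjugacy class
of `A`"). [cite: GompfAGT2010, §3 (conjugacy invariance)] -/
theorem isCappellShanesonSphereOf_akbulutKirby1979MatrixSq_iff {X : Type*} [TopologicalSpace X]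
    [ChartedSpace (𝔼 4) X] :
    IsCappellShanesonSphereOf akbulutKirby1979MatrixSq X ↔
      IsCappellShanesonSphereOf akbulutKirbyMatrix X := by
  rw [← akbulutKirby1979Conj_mul_sq_mul_inv, isCappellShanesonSphereOf_conj_iff]

/-- **`akbulutKirby1979_sphere_four` is the framing-free form of the theorem of [AK1] for the
matrix as printed**: some Cappell–Shaneson sphere of `A² = !![0, 0, 1; -1, 1, 0; 0, -1, 1]` — the
monodromy of `Ĉ` in Akbulut–Kirby 1979, p. 76 — is diffeomorphic to `S⁴` (loc. cit., p. 75,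
Theorem: "the double cover of `Q⁴`, called `Σ⁴`, is diffeomorphic to `S⁴`", `Σ⁴ = Ĉ ∪ S² × B²`
with the untwisted framing, p. 77), transported along the conjugacy `S A² S⁻¹ = A₀`. [cite: AkbulutKirby1979, p. 75 (Theorem: Σ⁴ ≅ S⁴)] -/
theorem akbulutKirby1979_sphere_four_iff_sq :
    akbulutKirby1979_sphere_four ↔
      ∃ (X : Type) (_ : TopologicalSpace X) (_ : T2Space X) (_ : SecondCountableTopology X)
        (_ : ChartedSpace (𝔼 4) X) (_ : IsManifold (𝓡 4) ∞ X) (_ : CompactSpace X),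
        IsCappellShanesonSphereOf akbulutKirby1979MatrixSq X ∧ Nonempty (X ≃ₘ⟮𝓡 4, 𝓡 4⟯ ↥(𝕊 4)) := by
  constructor
  · rintro ⟨X, _, _, _, _, _, _, hX, e⟩
    exact ⟨X, ‹_›, ‹_›, ‹_›, ‹_›, ‹_›, ‹_›,
      isCappellShanesonSphereOf_akbulutKirby1979MatrixSq_iff.2 hX, e⟩
  · rintro ⟨X, _, _, _, _, _, _, hX, e⟩
    exact ⟨X, ‹_›, ‹_›, ‹_›, ‹_›, ‹_›, ‹_›,
      isCappellShanesonSphereOf_akbulutKirby1979MatrixSq_iff.1 hX, e⟩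

/-- Equivalently, the standard `S⁴` is itself a Cappell–Shaneson sphere of the printed matrix
`A²` (combine `akbulutKirby1979_sphere_four_iff` with the conjugacy). [cite: AkbulutKirby1979, p. 75 (Theorem: Σ⁴ ≅ S⁴)] -/
theorem akbulutKirby1979_sphere_four_iff_sphere_sq :
    akbulutKirby1979_sphere_four ↔ IsCappellShanesonSphereOf akbulutKirby1979MatrixSq ↥(𝕊 4) := by
  rw [akbulutKirby1979_sphere_four_iff, isCappellShanesonSphereOf_akbulutKirby1979MatrixSq_iff]

end Literature.Topology.FourManifolds
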